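import Literature.Geometry.Lorentzian.SchwarzschildKillingAlgebraProofs
import Summits.FinalStateConjecture.FinalStateConjecture.Theorems.EIHFluxBalanceInertialRecessionBoostCalculus

/-!
# Route EIHFluxBalance — `InertialRecession` (E′), K1 / stub `stub_coerMomKernel` (Bk), far field, part F2pre:
# the boost with rational speed `2s/(1+s²)` along `e₁` and the Schwarzschild atoms in coordinates

Helper file for the crux `stmt-FinalStateConjecture-17403`. Infrastructure shared by the far-field row tables (F2b: linearised
Schwarzschild variation; F3: spin dipole): the rational parametrisation of the boost (`γ = (1+s²)/(1−s²)`, `γv = 2s/(1−s²)`,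
no square roots), the inverse boost `Λ(−v e₁)` as the standard `x`-boost matrix, and the atoms `sdot`, `spatialNorm` in
coordinates (`sdot_eq` is `SchwarzschildKillingAlgebraProofs`). No definitions, no `sorry`. [folklore]
-/

set_option linter.dupNamespace false

noncomputable section

open scoped Topology InnerProductSpace
open Filter Set Function Literature.Geometry.Lorentzian Literature.Geometry.Lorentzian.Schwarzschild

namespace Summit.FinalStateConjecture.FinalStateConjecture.Theorems.SublinearIsFree.Slaving

/-! ### The boost with speed `2s/(1+s²)` along `e₁` (rational parametrisation: `γ = (1+s²)/(1−s²)`) -/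

/-- `‖(2s/(1+s²)) e₁‖ = |2s/(1+s²)|`. [folklore] -/
theorem norm_vel (s : ℝ) : ‖((2 * s / (1 + s ^ 2)) • (EuclideanSpace.single 0 1 : E3))‖ = |2 * s / (1 + s ^ 2)| := by
  rw [norm_smul, PiLp.norm_single, norm_one, mul_one, Real.norm_eq_abs]

/-- For `|s| < 1` the speed `2s/(1+s²)` is `< 1`. [folklore] -/
theorem norm_vel_lt_one {s : ℝ} (hs : |s| < 1) : ‖((2 * s / (1 + s ^ 2)) • (EuclideanSpace.single 0 1 : E3))‖ < 1 := by
  rw [norm_vel, abs_div, abs_of_pos (by positivity : (0 : ℝ) < 1 + s ^ 2), div_lt_one (by positivity), abs_mul,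
    abs_of_pos (by norm_num : (0 : ℝ) < 2)]
  nlinarith [abs_nonneg s, sq_abs s, mul_pos (sub_pos.2 hs) (sub_pos.2 hs)]

/-- **`γ(2s/(1+s²)) = (1+s²)/(1−s²)`.** [folklore] -/
theorem gamma_vel {s : ℝ} (hs : |s| < 1) :
    Lorentz.gamma ((2 * s / (1 + s ^ 2)) • (EuclideanSpace.single 0 1 : E3)) = (1 + s ^ 2) / (1 - s ^ 2) := by
  unfold Lorentz.gamma
  rw [norm_vel, sq_abs]
  have h1 : 0 < 1 + s ^ 2 := by positivity
  have h2 : 0 < 1 - s ^ 2 := by nlinarith [abs_nonneg s, sq_abs s, mul_pos (sub_pos.2 hs) (sub_pos.2 hs)]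
  have h3 : 1 - (2 * s / (1 + s ^ 2)) ^ 2 = ((1 - s ^ 2) / (1 + s ^ 2)) ^ 2 := by
    field_simp; ring
  rw [h3, Real.sqrt_sq (div_pos h2 h1).le, inv_div]

/-- **The inverse boost in coordinates** (standard `x`-boost matrix):
`Λ(−v e₁)(u) = (γ(u⁰ − v u¹), γ(u¹ − v u⁰), u², u³)`, `v = 2s/(1+s²)`, `γ = (1+s²)/(1−s²)`, `γv = 2s/(1−s²)`. [folklore] -/
theorem boostCLM_neg_vel_apply {s : ℝ} (hs : |s| < 1) (u : E4) :
    Lorentz.boostCLM (-((2 * s / (1 + s ^ 2)) • (EuclideanSpace.single 0 1 : E3))) u =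
      ![(1 + s ^ 2) / (1 - s ^ 2) * u 0 - 2 * s / (1 - s ^ 2) * u 1,
        (1 + s ^ 2) / (1 - s ^ 2) * u 1 - 2 * s / (1 - s ^ 2) * u 0, u 2, u 3] := by
  have hγ : Lorentz.gamma (-((2 * s / (1 + s ^ 2)) • (EuclideanSpace.single 0 1 : E3))) = (1 + s ^ 2) / (1 - s ^ 2) := by
    rw [lorentzGamma_neg, gamma_vel hs]
  have h2 : (1 : ℝ) - s ^ 2 ≠ 0 := by
    have : 0 < 1 - s ^ 2 := by nlinarith [abs_nonneg s, sq_abs s, mul_pos (sub_pos.2 hs) (sub_pos.2 hs)]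
    exact this.ne'
  have h1 : (1 : ℝ) + s ^ 2 ≠ 0 := by positivity
  have hγ1 : (1 + s ^ 2) / (1 - s ^ 2) + 1 ≠ 0 := by
    rw [div_add_one h2]; exact div_ne_zero (by nlinarith [sq_nonneg s]) h2
  have hin : inner ℝ (-((2 * s / (1 + s ^ 2)) • (EuclideanSpace.single 0 1 : E3))) (E4.spatial u) =
      -(2 * s / (1 + s ^ 2)) * u 1 := by
    rw [inner_neg_left, real_inner_smul_left, EuclideanSpace.inner_single_left]
    simp [E4.spatial_apply]
  have h0 := Lorentz.boostCLM_apply_zero (-((2 * s / (1 + s ^ 2)) • (EuclideanSpace.single 0 1 : E3))) u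
  have hsp := Lorentz.spatial_boostCLM_apply (-((2 * s / (1 + s ^ 2)) • (EuclideanSpace.single 0 1 : E3))) u
  rw [hγ, hin] at h0 hsp
  have hc : ∀ i : Fin 3, Lorentz.boostCLM (-((2 * s / (1 + s ^ 2)) • (EuclideanSpace.single 0 1 : E3))) u i.succ =
      (E4.spatial u + ((((1 + s ^ 2) / (1 - s ^ 2)) ^ 2 / ((1 + s ^ 2) / (1 - s ^ 2) + 1) * (-(2 * s / (1 + s ^ 2)) * u 1) +
        (1 + s ^ 2) / (1 - s ^ 2) * u 0) • -((2 * s / (1 + s ^ 2)) • (EuclideanSpace.single 0 1 : E3)))) i :=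
    fun i ↦ by rw [← E4.spatial_apply, hsp]
  ext μ
  fin_cases μ
  · simp only [Fin.zero_eta, Fin.isValue]
    rw [h0]
    simp
    field_simp
    ring
  · have := hc 0
    simp only [Fin.succ_zero_eq_one] at this
    simp only [Fin.mk_one, Fin.isValue]
    rw [this]
    simp
    field_simp
    ring
  · have := hc 1
    simp only [Fin.succ_one_eq_two] at this
    simp only [Fin.reduceFinMk, Fin.isValue]
    rw [this]
    simp
  · have := hc 2
    have e3 : (2 : Fin 3).succ = 3 := rfl
    rw [e3] at this
    simp only [Fin.reduceFinMk, Fin.isValue]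
    rw [this]
    simp

/-! ### Atoms in coordinates -/

/-- `r² = (u¹)² + (u²)² + (u³)²` hence `r = √(…)`. [folklore] -/
theorem spatialNorm_eq_sqrt (u : E4) : E4.spatialNorm u = Real.sqrt (u 1 ^ 2 + u 2 ^ 2 + u 3 ^ 2) := by
  rw [← E4.spatialNorm_sq, Real.sqrt_sq (by unfold E4.spatialNorm; positivity)]

/-- Registered carrier `slaving_farFieldBoost_slaving12` of the crux item (= `gamma_vel`). [folklore] -/
theorem slaving_farFieldBoost_slaving12 : open Literature.Geometry.Lorentzian in ∀ {s : ℝ}, |s| < 1 → Lorentz.gamma ((2 * s / (1 + s ^ 2)) • (EuclideanSpace.single 0 1 : E3)) = (1 + s ^ 2) / (1 - s ^ 2) :=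
  fun hs ↦ gamma_vel hs

end Summit.FinalStateConjecture.FinalStateConjecture.Theorems.SublinearIsFree.Slaving
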